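import Summits.NavierStokesRegularity.FluidComputer.SuperLadder
import Summits.NavierStokesRegularity.FluidComputer.LerayDeadline
import HarnessLib

/-!
# Fluid computer — the SUPER-LADDER, time-integrated and scale-free forms (L54″, L54‴)

HONEST FRAMING (cell `pub-fluidc`, verbatim): *low prior, high value-of-information experiment on Tao's
machine paradigm; NOT a claim that NS blows up.* Theorem side of the cell; nothing here is evidence of blow-up.

Two readings of the super-ladder clock L54′ (`SuperLadder.superLadder_clock`: for `σ > 3/2`,
`κ_σ ν^{2σ/3} (T − t)^{−2σ/3} ≤ ‖u(0)‖₂^{(4σ−6)/3} R_σ(t)`, `R_σ(t) = ∑_j 4^{σj} ‖Δ̇_j u(t)‖₂²`), along every maximal smooth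
Leray–Hopf solution of the unforced Navier–Stokes system on `ℝ³` (`ν > 0`):

* `superLadder_lintegral_eq_top` (**L54″**) — raised to the power `3/(2σ)` the clock is `∝ (T − t)^{−1}`, so
  `∫⁻_{(t₀,T)} (‖u(0)‖₂^{(4σ−6)/3} R_σ(τ))^{3/(2σ)} dτ = ∞` on every terminal window
  (`SobolevLadderSerrin.lintegral_rpow_eq_top_of_clock`);
* `superLadder_energy_floor` (**L54‴ — THE SCALE-FREE FLOOR OF EVERY HIGH ROW**) — multiplying by the `2σ/3`-th power
  of Leray's deadline (L23: `4cν⁵(T − t) ≤ ‖u(t)‖₂⁴ ≤ ‖u(0)‖₂⁴`) cancels `T − t`: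
  `κ'_σ · ν^{4σ} ≤ ‖u(0)‖₂^{4σ−2} · R_σ(t)` at EVERY `t ∈ (0, T)` — every high-order dyadic energy of a realised blow-up
  stays above `κ'_σ ν^{4σ}/‖u(0)‖₂^{4σ−2}` throughout its life (both sides have the dimension of `R_σ`; compare L23′
  `2cν⁴ ≤ ‖u‖₂² Z` at `σ = 1` and L52-P).

HONEST SIZE NOTE: constants inexplicit; Benameur's (non-optimal below `5/2`) exponent inherited from L54; class = `ℝ³`
finite energy. Necessity only; nothing about sufficiency. 0 sorry; no new definitions, no named facts.

## References

* J. Benameur, J. Math. Anal. Appl. 371 (2010) 719–727. [Benameur2010]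
* J. Leray, Acta Math. 63 (1934), §19 (3.8)–(3.9) p. 224, §34 (6.4) p. 246. [Leray1934]
-/

noncomputable section

open MeasureTheory Set Function Filter Topology Metric
open scoped ENNReal NNReal
open Literature.Analysis.FluidPDE Literature.Analysis.FunctionSpaces
open Summit.NavierStokesRegularity.FluidComputer.SuperLadder

namespace Summit.NavierStokesRegularity.FluidComputer.SuperLadderForms

/-- **L54″ — THE `3/(2σ)`-POWER OF EVERY HIGH ROW IS NOT INTEGRABLE AT `T`.** For `σ > 3/2`, along every maximal smooth
Leray–Hopf solution of the unforced system (`ν > 0`), for every `t₀ ∈ [0, T)`: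
`∫⁻_{(t₀,T)} (‖u(0)‖₂^{(4σ−6)/3} ∑_j 4^{σj} ‖Δ̇_j u(τ)‖₂²)^{3/(2σ)} dτ = ∞`. [cite: Benameur2010, Thm. 1.1]
[cite: Leray1934, §19 (3.8)–(3.9) p. 224] -/
theorem superLadder_lintegral_eq_top (σ : ℝ) (hσ : 3 / 2 < σ) {ν T : ℝ} (hν : 0 < ν) (hT : 0 < T)
    {u : ℝ → EuclideanSpace ℝ (Fin 3) → EuclideanSpace ℝ (Fin 3)} {p : ℝ → EuclideanSpace ℝ (Fin 3) → ℝ}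
    (hmax : IsMaximalSmoothSolution ν 0 u p T) (hLH : IsLerayHopfOn T ν 0 (u 0) u) {t₀ : ℝ} (ht₀ : t₀ ∈ Ico 0 T) :
    ∫⁻ τ in Ioo t₀ T, (eLpNorm (u 0) 2 volume ^ ((4 * σ - 6) / 3) *
        ∑' j : ℤ, (2 : ℝ≥0∞) ^ ((2 * σ) * (j : ℝ)) * blockL2 (u τ) j ^ 2) ^ (3 / (2 * σ)) = ∞ := by
  obtain ⟨κ, hκ, H⟩ := superLadder_clock σ hσ
  have hσ0 : 0 < σ := by linarith
  have h := SobolevLadderSerrin.lintegral_rpow_eq_top_of_clock (a := 2 * σ / 3) (b := 2 * σ / 3) hκ hν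
    (by positivity) ht₀.2
    (X := fun τ => eLpNorm (u 0) 2 volume ^ ((4 * σ - 6) / 3) *
      ∑' j : ℤ, (2 : ℝ≥0∞) ^ ((2 * σ) * (j : ℝ)) * blockL2 (u τ) j ^ 2)
    (fun τ hτ => H ν T hν hT u p hmax hLH τ ⟨ht₀.1.trans_lt hτ.1, hτ.2⟩)
  rw [show (1 : ℝ) / (2 * σ / 3) = 3 / (2 * σ) by field_simp] at h
  exact h

/-- **L54‴ — THE SCALE-FREE FLOOR OF EVERY HIGH ROW.** For every `σ > 3/2` there is `κ' = κ'_σ > 0` such that along every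
maximal smooth solution `(u, p)` of the unforced Navier–Stokes system on `ℝ³ × [0, T)` (`ν > 0`) which is Leray–Hopf from
`u 0`, at EVERY `t ∈ (0, T)`: `κ' · ν^{4σ} ≤ ‖u(0)‖₂^{4σ−2} · ∑_j 4^{σj} ‖Δ̇_j u(t)‖₂²` (L54′ × the `2σ/3`-th power of Leray's
deadline L23, which cancels `T − t`; `κ' = κ_σ (4c)^{2σ/3}`). [cite: Benameur2010, Thm. 1.1]
[cite: Leray1934, §34 (6.4) p. 246] -/
theorem superLadder_energy_floor (σ : ℝ) (hσ : 3 / 2 < σ) :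
    ∃ κ' : ℝ, 0 < κ' ∧ ∀ (ν T : ℝ), 0 < ν → 0 < T →
      ∀ (u : ℝ → EuclideanSpace ℝ (Fin 3) → EuclideanSpace ℝ (Fin 3)) (p : ℝ → EuclideanSpace ℝ (Fin 3) → ℝ),
      IsMaximalSmoothSolution ν 0 u p T → IsLerayHopfOn T ν 0 (u 0) u →
      ∀ t ∈ Ioo 0 T,
        ENNReal.ofReal (κ' * ν ^ (4 * σ)) ≤
          eLpNorm (u 0) 2 volume ^ (4 * σ - 2) * ∑' j : ℤ, (2 : ℝ≥0∞) ^ ((2 * σ) * (j : ℝ)) * blockL2 (u t) j ^ 2 := by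
  obtain ⟨κ, hκ, H⟩ := superLadder_clock σ hσ
  obtain ⟨c, hc, Hd⟩ := LerayDeadline.deadline
  have hσ0 : 0 < σ := by linarith
  refine ⟨κ * (4 * c) ^ (2 * σ / 3), by positivity, fun ν T hν hT u p hmax hLH t ht => ?_⟩
  have hTt : 0 < T - t := sub_pos.2 ht.2
  set E : ℝ≥0∞ := eLpNorm (u 0) 2 volume with hE
  have hEtop : E ≠ ⊤ := (hLH.memLp 0 ⟨le_rfl, hT.le⟩).eLpNorm_ne_top
  set Er : ℝ := E.toReal with hEr
  set R : ℝ≥0∞ := ∑' j : ℤ, (2 : ℝ≥0∞) ^ ((2 * σ) * (j : ℝ)) * blockL2 (u t) j ^ 2 with hR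
  -- the deadline at `t`, pushed to the datum by energy decay: `4cν⁵(T − t) ≤ Er⁴`
  have hdead : 4 * c * ν ^ 5 * (T - t) ≤ Er ^ 4 := by
    have h1 := Hd ν T hν hT u p hmax hLH t ⟨ht.1.le, ht.2⟩
    have h2 : (eLpNorm (u t) 2 volume).toReal ≤ Er :=
      ENNReal.toReal_mono hEtop (hLH.eLpNorm_le_eLpNorm_datum hν.le (hLH.memLp 0 ⟨le_rfl, hT.le⟩) ⟨ht.1.le, ht.2.le⟩)
    exact h1.trans (pow_le_pow_left₀ ENNReal.toReal_nonneg h2 4)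
  have hK0 : 0 < 4 * c * ν ^ 5 := by positivity
  have hErpos : 0 < Er := by
    have h4 : 0 < Er ^ 4 := lt_of_lt_of_le (by positivity) hdead
    have hne : Er ≠ 0 := by
      intro h
      rw [h] at h4
      simp at h4
    exact lt_of_le_of_ne ENNReal.toReal_nonneg (Ne.symm hne)
  -- `(T − t)^{−2σ/3} ≥ (Er⁴/(4cν⁵))^{−2σ/3}`
  have hD : T - t ≤ Er ^ 4 / (4 * c * ν ^ 5) := by rw [le_div_iff₀ hK0]; linarith
  have hpow : (Er ^ 4 / (4 * c * ν ^ 5)) ^ (-(2 * σ / 3)) ≤ (T - t) ^ (-(2 * σ / 3)) := by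
    rw [Real.rpow_neg (by positivity), Real.rpow_neg hTt.le]
    exact inv_anti₀ (Real.rpow_pos_of_pos hTt _) (Real.rpow_le_rpow hTt.le hD (by positivity))
  -- real algebra: `Er^{8σ/3} κ ν^{2σ/3} (Er⁴/(4cν⁵))^{−2σ/3} = κ (4c)^{2σ/3} ν^{4σ}`
  have halg : Er ^ (8 * σ / 3) * (κ * ν ^ (2 * σ / 3) * (Er ^ 4 / (4 * c * ν ^ 5)) ^ (-(2 * σ / 3))) =
      κ * (4 * c) ^ (2 * σ / 3) * ν ^ (4 * σ) := by
    rw [Real.rpow_neg (by positivity), Real.div_rpow (by positivity) hK0.le, inv_div,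
      Real.mul_rpow (by positivity) (by positivity), ← Real.rpow_natCast ν 5, ← Real.rpow_mul hν.le,
      ← Real.rpow_natCast Er 4, ← Real.rpow_mul hErpos.le]
    have e1 : ((4 : ℕ) : ℝ) * (2 * σ / 3) = 8 * σ / 3 := by push_cast; ring
    have e2 : ((5 : ℕ) : ℝ) * (2 * σ / 3) = 10 * σ / 3 := by push_cast; ring
    rw [e1, e2]
    have hE83 : 0 < Er ^ (8 * σ / 3) := Real.rpow_pos_of_pos hErpos _
    field_simp
    rw [← Real.rpow_add hν]
    congr 1
    ring
  have hreal : κ * (4 * c) ^ (2 * σ / 3) * ν ^ (4 * σ) ≤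
      Er ^ (8 * σ / 3) * (κ * ν ^ (2 * σ / 3) * (T - t) ^ (-(2 * σ / 3))) := by
    rw [← halg]
    exact mul_le_mul_of_nonneg_left (mul_le_mul_of_nonneg_left hpow (by positivity)) (by positivity)
  -- assemble in `ℝ≥0∞`
  have hclock := H ν T hν hT u p hmax hLH t ht
  have hE83 : E ^ (8 * σ / 3) = ENNReal.ofReal (Er ^ (8 * σ / 3)) := by
    rw [hEr, ← ENNReal.ofReal_rpow_of_nonneg ENNReal.toReal_nonneg (by positivity), ENNReal.ofReal_toReal hEtop]
  have hEsplit : E ^ (4 * σ - 2) = E ^ (8 * σ / 3) * E ^ ((4 * σ - 6) / 3) := by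
    rw [← ENNReal.rpow_add_of_nonneg _ _ (by positivity) (by linarith)]
    congr 1
    ring
  calc ENNReal.ofReal (κ * (4 * c) ^ (2 * σ / 3) * ν ^ (4 * σ))
      ≤ ENNReal.ofReal (Er ^ (8 * σ / 3) * (κ * ν ^ (2 * σ / 3) * (T - t) ^ (-(2 * σ / 3)))) :=
        ENNReal.ofReal_le_ofReal hreal
    _ = E ^ (8 * σ / 3) * ENNReal.ofReal (κ * ν ^ (2 * σ / 3) * (T - t) ^ (-(2 * σ / 3))) := by
        rw [ENNReal.ofReal_mul (by positivity), hE83]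
    _ ≤ E ^ (8 * σ / 3) * (E ^ ((4 * σ - 6) / 3) * R) := mul_le_mul' le_rfl hclock
    _ = E ^ (4 * σ - 2) * R := by rw [hEsplit, mul_assoc]

end Summit.NavierStokesRegularity.FluidComputer.SuperLadderForms

end
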